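import Mathlib.RingTheory.Finiteness.Descent
import Mathlib.RingTheory.Flat.FaithfullyFlat.Basic
import Mathlib.RingTheory.Flat.EquationalCriterion
import Mathlib.RingTheory.IsTensorProduct
import Literature.RingTheory.Flat.FaithfullyFlatModuleDescent
import HarnessLib

/-!
# Finite presentation and finite projectivity of MODULES descend along faithfully flat ring maps (Stacks 03C4, 058S)

Topic `Literature/RingTheory/Flat`, namespace `Literature.RingTheory.Flat.FaithfullyFlatDescent`.  THEOREMS ONLY; no definition, no named fact,
no instance, no notation, no `sorry`.  Cell `pub/hodgecm-mathlib` (D-0151), P6b wave C row (E4) (desk F0P6b-plan (g14) 10:01:59Z; consumer BY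
NAME = the `hproj` binder of the §D module-descent organ (ii) of `stub_L4B1uD_mumfordLambdaDescent`: the descended module of a finite projective
module along the finite FLAT torsor quotient is finite projective); prover seat hodgecm-mathlib-B-p04 (g53).  Lane `--supports
stmt-HodgeConjecture-24832`; count-neutral.  HC_CM is proved only modulo the printed citations (2 remaining named inputs hLiu418 =
`stmt-HodgeConjecture-24832`, h413 = `stmt-HodgeConjecture-24833`) until rung 0 closes; nothing here bears on it.

THE PRINT ([StacksProject] Tag 03C4 = Algebra, Lemma 10.83.2 «`R → S` faithfully flat, `M` an `R`-module: `M` is finite ∕ finitely presented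
∕ flat iff `S ⊗_R M` is»; Tag 058S «finite projective descends along faithfully flat ring maps»).  Mathlib already has the FINITE clause
(`Module.Finite.of_finite_tensorProduct_of_faithfullyFlat`), the FLAT clause (`Module.Flat.of_flat_tensorProduct`), finite presentation
descent for ALGEBRAS (`Algebra.FinitePresentation.of_finitePresentation_tensorProduct_of_faithfullyFlat`) and «finitely presented + flat ⇒
projective» (`Module.Flat.projective_of_finitePresentation`, Tag 00NX); this file supplies the two MODULE clauses Mathlib lacks:

* §1 (tensor form) **`finitePresentation_of_faithfullyFlat_tensorProduct`** — `S ⊗_R M` finitely presented over `S` ⟹ `M` finitely presented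
  over `R` (route: a surjection `l : Rⁿ → M`; `S` flat makes `0 → S ⊗ ker l → Sⁿ → S ⊗ M → 0` exact (`range_baseChange_subtype_ker_eq`), so
  `S ⊗ ker l` is finitely generated (Mathlib `Module.FinitePresentation.fg_ker`), hence `ker l` is (finite descent), hence `M` is finitely
  presented (`Module.finitePresentation_of_surjective`)); **`projective_of_faithfullyFlat_tensorProduct`**,
  **`finite_projective_of_faithfullyFlat_tensorProduct`** — `S ⊗_R M` finite projective ⟹ `M` finite projective (f.p. + flat descend, then
  Tag 00NX).
* §2 (`IsBaseChange` form, the currency of ★ `AmitsurDescentData` ∕ ★ `FaithfullyFlatModuleDescent`) `finite_of_isBaseChange`,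
  `flat_of_isBaseChange`, `finitePresentation_of_isBaseChange`, **`finite_projective_of_isBaseChange`**, `projective_of_isBaseChange` — for `f : M → P` with
  `IsBaseChange S f`.
* §3 (descent-datum form) **`finite_projective_eqLocus`** — for a descent datum `(θ, hε, hδ)` on a finite projective `S`-module `P` (comodule
  spelling of ★ `FaithfullyFlatModuleDescent`), the descended module `{m | θ m = 1 ⊗ m}` is finite projective over `R` (★
  `ModuleDescent.isBaseChange_subtype` + §2).

## References
* [StacksProject] The Stacks Project, Tag 03C4 (Algebra, Lemma 10.83.2) and Tag 058S (finite projective modules descend); Tag 00NX.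

## Design notes
* Searches: Mathlib `rg FinitePresentation` over `RingTheory/Flat/FaithfullyFlat/*`, `RingTheory/Finiteness/Descent` — module-level f.p. ∕
  projective descent absent (only `Module.Finite`, `Module.Flat`, and the `Algebra.*` versions); tree ★ `Flat/FinitePresentationDescent` ∕
  `FaithfullyFlatDescentFP` are Stacks 02KK for ALGEBRAS; ★ `FaithfullyFlatModuleDescent` is effectivity without finiteness.  Nothing restated.
* `range_baseChange_subtype_ker_eq` is stated `S`-linearly (`LinearMap.baseChange`) so that `Module.FinitePresentation.fg_ker` over `S` applies
  verbatim; Mathlib's `lTensor_exact` is the `R`-linear statement with the same underlying functions.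
-/

universe u v w w'

open TensorProduct

namespace Literature.RingTheory.Flat.FaithfullyFlatDescent

variable {R : Type u} {S : Type v} [CommRing R] [CommRing S] [Algebra R S]
variable {M : Type w} [AddCommGroup M] [Module R M]

/-! ## §1 Tensor form: `S ⊗_R M` finitely presented ∕ finite projective ⟹ `M` is -/

/-- Exactness of `S ⊗_R –` on `0 → ker l → N → M → 0` for a surjection `l` and FLAT `S` (Mathlib `lTensor_exact` +
`Module.Flat.lTensor_preserves_injective_linearMap`), in `baseChange` (`S`-linear) dress: the kernel of `l ⊗ S` is the range of `(ker l) ⊗ S`.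
[cite: StacksProject, Tag 03C4] -/
theorem range_baseChange_subtype_ker_eq {N : Type w'} [AddCommGroup N] [Module R N] (l : N →ₗ[R] M)
    (hl : Function.Surjective l) :
    LinearMap.range ((LinearMap.ker l).subtype.baseChange S) = LinearMap.ker (l.baseChange S) := by
  have hex : Function.Exact (LinearMap.ker l).subtype l := LinearMap.exact_subtype_ker_map l
  have hex' : Function.Exact ((LinearMap.ker l).subtype.baseChange S) (l.baseChange S) := lTensor_exact S hex hl
  exact (LinearMap.exact_iff.mp hex').symm

/-- **Finite presentation descends along faithfully flat ring maps** (modules): if `S` is faithfully flat over `R` and `S ⊗_R M` is a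
finitely presented `S`-module, then `M` is a finitely presented `R`-module. [cite: StacksProject, Tag 03C4] -/
theorem finitePresentation_of_faithfullyFlat_tensorProduct [Module.FaithfullyFlat R S] [Module.FinitePresentation S (S ⊗[R] M)] :
    Module.FinitePresentation R M := by
  haveI : Module.Finite R M := Module.Finite.of_finite_tensorProduct_of_faithfullyFlat S
  obtain ⟨n, l, hl⟩ := Module.Finite.exists_fin' R M
  -- the kernel `K` of `l : Rⁿ → M`
  set K := LinearMap.ker l with hK
  -- `S ⊗ K ≅ ker (l ⊗ S)` is finitely generated over `S`
  have hfg : (LinearMap.ker (l.baseChange S)).FG :=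
    Module.FinitePresentation.fg_ker (l.baseChange S) (LinearMap.lTensor_surjective S hl)
  have hinj : Function.Injective (K.subtype.baseChange S) :=
    Module.Flat.lTensor_preserves_injective_linearMap K.subtype K.injective_subtype
  haveI : Module.Finite S (S ⊗[R] K) := by
    have e : (S ⊗[R] K) ≃ₗ[S] LinearMap.range (K.subtype.baseChange S) := LinearEquiv.ofInjective _ hinj
    haveI : Module.Finite S (LinearMap.range (K.subtype.baseChange S)) := by
      rw [Module.Finite.iff_fg, range_baseChange_subtype_ker_eq l hl]
      exact hfg
    exact Module.Finite.equiv e.symm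
  haveI : Module.Finite R K := Module.Finite.of_finite_tensorProduct_of_faithfullyFlat S
  exact Module.finitePresentation_of_surjective l hl (Module.Finite.iff_fg.mp inferInstance)

/-- **Finite projective descends along faithfully flat ring maps**: if `S` is faithfully flat over `R` and `S ⊗_R M` is a finite projective
`S`-module, then `M` is a projective `R`-module (finite by Mathlib `Module.Finite.of_finite_tensorProduct_of_faithfullyFlat`).  Route:
finite projective ⇒ finitely presented + flat over `S`; both descend; finitely presented + flat ⇒ projective (Mathlib
`Module.Flat.projective_of_finitePresentation`). [cite: StacksProject, Tag 058S] -/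
theorem projective_of_faithfullyFlat_tensorProduct [Module.FaithfullyFlat R S] [Module.Finite S (S ⊗[R] M)]
    [Module.Projective S (S ⊗[R] M)] : Module.Projective R M := by
  haveI : Module.FinitePresentation S (S ⊗[R] M) := Module.finitePresentation_of_projective S (S ⊗[R] M)
  haveI : Module.FinitePresentation R M := finitePresentation_of_faithfullyFlat_tensorProduct (S := S)
  haveI : Module.Flat R M := Module.Flat.of_flat_tensorProduct R M S
  exact Module.Flat.projective_of_finitePresentation

/-- **Finite projective descends along faithfully flat ring maps** (both conjuncts). [cite: StacksProject, Tag 058S] -/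
theorem finite_projective_of_faithfullyFlat_tensorProduct [Module.FaithfullyFlat R S] [Module.Finite S (S ⊗[R] M)]
    [Module.Projective S (S ⊗[R] M)] : Module.Finite R M ∧ Module.Projective R M :=
  ⟨Module.Finite.of_finite_tensorProduct_of_faithfullyFlat S, projective_of_faithfullyFlat_tensorProduct (S := S)⟩

/-! ## §2 `IsBaseChange` form -/

section BaseChange

variable {P : Type w'} [AddCommGroup P] [Module R P] [Module S P] [IsScalarTower R S P] {f : M →ₗ[R] P}

/-- Finiteness descends (base-change form): if `f : M → P` exhibits the `S`-module `P` as `S ⊗_R M` and `P` is finite over `S`, then `M` is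
finite over `R`. [cite: StacksProject, Tag 03C4] -/
theorem finite_of_isBaseChange [Module.FaithfullyFlat R S] (hf : IsBaseChange S f) [Module.Finite S P] : Module.Finite R M := by
  haveI : Module.Finite S (S ⊗[R] M) := Module.Finite.equiv hf.equiv.symm
  exact Module.Finite.of_finite_tensorProduct_of_faithfullyFlat S

/-- Flatness descends (base-change form): Mathlib `Module.Flat.of_flat_tensorProduct` transported along `IsBaseChange.equiv`.
[cite: StacksProject, Tag 03C4] -/
theorem flat_of_isBaseChange [Module.FaithfullyFlat R S] (hf : IsBaseChange S f) [Module.Flat S P] : Module.Flat R M := by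
  haveI : Module.Flat S (S ⊗[R] M) := Module.Flat.of_linearEquiv hf.equiv
  exact Module.Flat.of_flat_tensorProduct R M S

/-- Finite presentation descends (base-change form). [cite: StacksProject, Tag 03C4] -/
theorem finitePresentation_of_isBaseChange [Module.FaithfullyFlat R S] (hf : IsBaseChange S f) [Module.FinitePresentation S P] :
    Module.FinitePresentation R M := by
  haveI : Module.FinitePresentation S (S ⊗[R] M) :=
    Module.finitePresentation_of_surjective (hf.equiv.symm : P →ₗ[S] S ⊗[R] M) hf.equiv.symm.surjective
      (by rw [LinearEquiv.ker]; exact Submodule.fg_bot)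
  exact finitePresentation_of_faithfullyFlat_tensorProduct (S := S)

/-- **Finite projective descends (base-change form)** — the supplier of the `hproj` binder of the §D module descent: if `S` is faithfully
flat over `R`, `f : M → P` exhibits `P` as `S ⊗_R M`, and `P` is finite projective over `S`, then `M` is finite projective over `R`.
[cite: StacksProject, Tag 058S] -/
theorem finite_projective_of_isBaseChange [Module.FaithfullyFlat R S] (hf : IsBaseChange S f) [Module.Finite S P]
    [Module.Projective S P] : Module.Finite R M ∧ Module.Projective R M := by
  haveI : Module.Finite S (S ⊗[R] M) := Module.Finite.equiv hf.equiv.symm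
  haveI : Module.Projective S (S ⊗[R] M) := Module.Projective.of_equiv hf.equiv.symm
  exact finite_projective_of_faithfullyFlat_tensorProduct (S := S)

/-- Projectivity descends (base-change form). [cite: StacksProject, Tag 058S] -/
theorem projective_of_isBaseChange [Module.FaithfullyFlat R S] (hf : IsBaseChange S f) [Module.Finite S P] [Module.Projective S P] :
    Module.Projective R M :=
  (finite_projective_of_isBaseChange hf).2

end BaseChange

/-! ## §3 Descent-datum form: the descended module of a finite projective module is finite projective -/

section Datum

variable (R S) in
/-- **The descended module of a finite projective module is finite projective**: for `S` faithfully flat over `R` and a descent datum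
`θ : P → S ⊗_R P` (counital `hε`, coassociative `hδ`, the comodule spelling of ★ `FaithfullyFlatModuleDescent`) on a finite projective
`S`-module `P`, the `R`-module `{m | θ m = 1 ⊗ m}` is finite projective — ★ `ModuleDescent.isBaseChange_subtype` exhibits `P` as its base
change, and §2 descends. [cite: StacksProject, Tag 058S] -/
theorem finite_projective_eqLocus [Module.FaithfullyFlat R S] {P : Type w'} [AddCommGroup P] [Module R P] [Module S P] [IsScalarTower R S P]
    (θ : P →ₗ[S] S ⊗[R] P)
    (hε : ∀ m : P, (LinearMap.id : P →ₗ[R] P).liftBaseChange S (θ m) = m)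
    (hδ : ∀ m : P, LinearMap.lTensor S (θ.restrictScalars R) (θ m) = LinearMap.lTensor S (TensorProduct.mk R S P 1) (θ m))
    [Module.Finite S P] [Module.Projective S P] :
    Module.Finite R (LinearMap.eqLocus (θ.restrictScalars R) (TensorProduct.mk R S P 1)) ∧
      Module.Projective R (LinearMap.eqLocus (θ.restrictScalars R) (TensorProduct.mk R S P 1)) :=
  finite_projective_of_isBaseChange (ModuleDescent.isBaseChange_subtype R S θ hε hδ)

end Datum

end Literature.RingTheory.Flat.FaithfullyFlatDescent
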